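import Literature.MathematicalPhysics.QuantumLattice.HeatKernelGroup
import HarnessLib

/-!
# Gauge invariance of the heat-kernel lattice weight: discharge of
`groupHeatKernelWeight_gaugeTransform`

Sibling proof file of `Literature/MathematicalPhysics/QuantumLattice/HeatKernelGroup.lean` (next to
`HeatKernelGroupProofs.lean`, the time-rescaling discharge): it discharges the named fact
`Literature.MathematicalPhysics.QuantumLattice.groupHeatKernelWeight_gaugeTransform` (D-0014) as
`theorem groupHeatKernelWeight_gaugeTransform_holds : groupHeatKernelWeight_gaugeTransform`,
i.e. for a heat kernel `p` of the compact group `G` (`IsGroupHeatKernel p`), `t > 0`, every gauge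
transformation `g : Λ → G` of the torus `Λ = (ℤ/L)^d` and every configuration `U`,
`∏_q p_t((U^g)_q) = ∏_q p_t(U_q)` (`groupHeatKernelWeight p t (gaugeTransform g U) =
groupHeatKernelWeight p t U`).  No statement is introduced or changed here; the one auxiliary
declaration (`plaquetteHolonomy_gaugeTransform`) is proved.

## Source

B. K. Driver, *YM₂: continuum expectations, lattice convergence, and lassos*, Comm. Math. Phys.
**123** (1989) 575–616, §7 (Def. 7.1, (7.1), pp. 597–598) and §8 (Def. 8.3, the "Villain action", p. 601)
[cite: Driver1989]: the heat-kernel (Villain-type) lattice action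
`∏_{plaquettes} p_t(U_q)` and its gauge invariance.  (The paper is held by the literature store,
key `paper:url-6645d44e7164` = the Project Euclid open copy euclid.cmp/1104178984; the argument below
is the standard two-line one, identical to the gauge invariance of the Wilson action,
`Literature.MathematicalPhysics.QuantumFieldTheory.wilsonAction_gaugeTransform`, Seiler LNP 159 §1,
with "the trace is cyclic" replaced by "`p_t` is central".)

## Proof

* `plaquetteHolonomy_gaugeTransform`: under `U ↦ U^g`, `U^g(x,i) = g(x) U(x,i) g(x+eᵢ)⁻¹`, the
  holonomy of the plaquette based at `x` in the `(i,j)` plane transforms by conjugation,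
  `(U^g)_p = g(x) U_p g(x)⁻¹` — the inner factors cancel because `x + eᵢ + eⱼ = x + eⱼ + eᵢ` on the
  torus.
* `groupHeatKernelWeight_gaugeTransform_holds`: each factor `p_t((U^g)_q) = p_t(g(x) U_q g(x)⁻¹)
  = p_t(U_q)` by `IsGroupHeatKernel.central`; conclude with `Finset.prod_congr`.
-/

open Literature.MathematicalPhysics.QuantumFieldTheory (GaugeConfig plaquetteHolonomy)

noncomputable section

namespace Literature.MathematicalPhysics.QuantumLattice

variable {G : Type*} [Group G]
variable {d L : ℕ}

/-- Under a gauge transformation `U ↦ U^g`, `U^g(x,i) = g(x) U(x,i) g(x+eᵢ)⁻¹`, the plaquette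
holonomy based at `x` transforms by conjugation: `(U^g)_p = g(x) U_p g(x)⁻¹` (the intermediate
factors `g(x+eᵢ)⁻¹ g(x+eᵢ)`, `g(x+eᵢ+eⱼ)⁻¹ g(x+eⱼ+eᵢ)`, `g(x+eⱼ) g(x+eⱼ)⁻¹` cancel on the torus).
This is the computation inside `QuantumFieldTheory.wilsonAction_gaugeTransform` (Seiler LNP 159
§1; Driver, CMP 123 (1989) §7), recorded as a lemma for any group `G`. [folklore] -/
theorem plaquetteHolonomy_gaugeTransform (g : QuantumFieldTheory.Site d L → G)
    (U : GaugeConfig d L G) (x : QuantumFieldTheory.Site d L) (i j : Fin d) :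
    plaquetteHolonomy (QuantumFieldTheory.gaugeTransform g U) x i j =
      g x * plaquetteHolonomy U x i j * (g x)⁻¹ := by
  have hshift : (x.shift j).shift i = (x.shift i).shift j := by
    simp only [QuantumFieldTheory.Site.shift, add_assoc,
      add_comm (Pi.single (M := fun _ => ZMod L) j 1)]
  simp only [plaquetteHolonomy, QuantumFieldTheory.gaugeTransform, hshift, mul_inv_rev, inv_inv]
  group

variable [TopologicalSpace G] [IsTopologicalGroup G] [CompactSpace G] [MeasurableSpace G]
  [BorelSpace G]

/-- **Gauge invariance of the heat-kernel weight** — discharge of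
`groupHeatKernelWeight_gaugeTransform` (Driver, CMP 123 (1989) §7, Def. 7.1: the heat-kernel action
`∏_q p_t(U_q)` is a gauge-invariant function of the configuration).  Every plaquette holonomy
transforms by conjugation, `(U^g)_q = g(x) U_q g(x)⁻¹` (`plaquetteHolonomy_gaugeTransform`), and
each `p_t`, `t > 0`, is a class function (`IsGroupHeatKernel.central`), so the product over
plaquettes is unchanged factor by factor. [cite: Driver1989, §7 Def. 7.1 (p. 597)] -/
theorem groupHeatKernelWeight_gaugeTransform_holds :
    groupHeatKernelWeight_gaugeTransform (G := G) (d := d) (L := L) := by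
  intro _ p hp t ht g U
  unfold groupHeatKernelWeight
  refine Finset.prod_congr rfl fun q _ => ?_
  rw [plaquetteHolonomy_gaugeTransform, hp.central t ht]

end Literature.MathematicalPhysics.QuantumLattice
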